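import Literature.Analysis.ODE.FlowWithin
import HarnessLib

/-!
# Poincaré sections: transversal crossings and the derivative of the Poincaré map

A Literature anchor for the POINCARÉ-MAP layer of rigorous ODE integration of Lohner type
([WilczakZgliczynski2007, §7]; the `[Cn]PoincareMap` classes of CAPD; the verified solver of
[Immler2018VerifiedODESolver, §2.2.2 and §6.7]).  A section is the level set `Π = {y | a y = c}`
of a continuous linear functional `a : E →L[ℝ] ℝ` on a real normed space `E` (a coordinate
section `{y | y j = c}` of `ℝⁿ` is `a = ContinuousLinearMap.proj j`; an affine section
`{⟨y, n⟩ = c}` is `a = ⟨·, n⟩`), and a piece of trajectory of `y' = f (y)` is TRANSVERSAL to it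
when `a (f (y t)) > 0` along the piece ([WilczakZgliczynski2007, §7 Def. 11]:
`⟨∇α(y₀), f(y₀)⟩ ≠ 0`; we fix the sign, the other sign being the same statement for `-a`,
`-c`).  This is exactly what a rigorous integrator checks on its enclosures when it "crosses
the section": the sign of `a ∘ f` on an enclosure of the crossing phase, `a < c` on the
enclosures before it and `a ≤ c`, `c ≤ a` at the two ends of a time window.

## Main statements

* `strictMonoOn_section_of_transversal`: along a transversal piece of trajectory the section
  coordinate `t ↦ a (y t)` is strictly increasing.
* `existsUnique_section_crossing`: the `C⁰` crossing theorem — if `y` solves `y' = f (y)` on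
  `[t₁, t₂]` transversally and `a (y s_lo) ≤ c ≤ a (y s_hi)` for a window
  `[s_lo, s_hi] ⊆ [t₁, t₂]`, then `y` meets `Π` at exactly one time of `[t₁, t₂]`; that time
  lies in the window, `y` is strictly on the near side `{a < c}` before it and strictly on the
  far side `{c < a}` after it.  `existsUnique_first_section_crossing` adds an approach phase
  `[t₀, t₁]` spent on the near side and concludes that this is the FIRST time in `[t₀, t₂]` at
  which `y` meets `Π` — the return time `t_Π` of [WilczakZgliczynski2007, §7] /
  [Immler2018VerifiedODESolver, §2.2.2], hence the `C⁰` Poincaré map `P = y (t_Π)` is well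
  defined on every initial condition covered by such a certificate.
* `hasFDerivWithinAt_crossingTime_poincareMap`: the `C¹` theorem.  For a family of solutions
  `u x : [0, h] → S`, `x ∈ W` (`IsSolutionFamily f S W h u`) with bounded continuous field on
  `S`, transversal along the family, crossing times `s x ∈ [0, h]` (`a (u x (s x)) = c`), the
  solution map `x ↦ u x τ` continuous within `W` at `x₀` for every `τ`, and the derivative `J`
  WITHIN `W` at `x₀` of the frozen-time flow map `x ↦ u x (s x₀)` (as delivered by a
  `C¹`-Lohner step, cf. `Literature.Analysis.ODE.hasFDerivWithinAt_flow_of_variationalEnclosure`),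
  the crossing time `s` and the Poincaré map `P x = u x (s x)` are differentiable within `W` at
  `x₀`, with
  `D s = -(a ∘ J) / a (f (P x₀))` and `D P = J - f (P x₀) ⊗ (a ∘ J) / a (f (P x₀))`
  — the formulas for `∂t_P/∂x_j` and `∂P_i/∂x_j` of [WilczakZgliczynski2007, §7] and
  [Immler2018VerifiedODESolver, Thm. 8 and §6.7].  `hasFDerivWithinAt_poincareMap_coordSection`
  spells the entries out for a coordinate section of `ℝ^ι`:
  `(D P v) i = (J v) i - f_i (P x₀) (J v) j / f_j (P x₀)`, `D s v = -(J v) j / f_j (P x₀)`,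
  i.e. `D P = (I - f (P) e_jᵀ / f_j (P)) · D_x φ(s (x₀), ·)`.

## Proof sketches

The `C⁰` part is the strict monotonicity of `a ∘ y` (its derivative within `[t₁, t₂]` is
`a (f (y t)) > 0`, `strictMonoOn_of_hasDerivWithinAt_pos`) plus the intermediate value
theorem.  The `C¹` part is proved WITHOUT the implicit function theorem (which would need open
neighbourhoods and strict differentiability, while a Lohner certificate only gives derivatives
within the box `W`): (1) `s` is continuous within `W` at `x₀`, by strict monotonicity of
`a ∘ u x` and continuity of `x ↦ u x τ` at the two times `s x₀ ± η/2`; (2) by the mean value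
inequality along `u x` between `s x₀` and `s x`,
`u x (s x) - u x (s x₀) - (s x - s x₀) • f (P x₀) = o(s x - s x₀)` (the field along that
piece is uniformly close to `f (P x₀)` by (1), the speed bound and continuity of `f`);
(3) `u x (s x₀) - P x₀ - J (x - x₀) = o(x - x₀)` is the hypothesis on `J`; (4) applying `a`
to the sum of (2) and (3) and using `a (u x (s x)) = c = a (P x₀)` gives first
`s x - s x₀ = O(x - x₀)` and then the two little-`o` expansions that are the claimed
derivatives.

## References

* [WilczakZgliczynski2007] D. Wilczak, P. Zgliczyński, *Cʳ-Lohner algorithm*, Schedae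
  Informaticae 20 (2011) 9–46, arXiv:0704.0720 — §7 "Derivatives of Poincaré map": Def. 11
  (local section, transversality), the return time `t_P` defined by `α(φ(t_P(x), x)) = C`,
  `P(x) = φ(t_P(x), x)`, and the formulas for `∂P_i/∂x_j` and `∂t_P/∂x_j`.
* [Immler2018VerifiedODESolver] F. Immler, *A verified ODE solver and the Lorenz attractor*,
  J. Automat. Reason. 61 (2018) 73–111 — §2.2.2 (return time, Poincaré map, Thm. 8: derivative
  of the Poincaré map), §6.7 (the hyperplane case).
* [Zgliczynski2002C1Lohner] P. Zgliczyński, *C¹-Lohner algorithm*, Found. Comput. Math. 2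
  (2002) 429–465 (the `C¹` enclosures `J` this file consumes).
-/

noncomputable section

open Set Metric Filter Topology Asymptotics

open scoped NNReal

namespace Literature.Analysis.ODE

section Crossing

variable {E : Type*} [NormedAddCommGroup E] [NormedSpace ℝ E]

/-- Along a solution of `y' = f(y)` on `[t₁, t₂]` that is TRANSVERSAL to the section
`{a = c}` in the sense `a (f (y t)) > 0`, the section coordinate `t ↦ a (y t)` is strictly
increasing. [cite: WilczakZgliczynski2007, §7 Def. 11] -/
theorem strictMonoOn_section_of_transversal {y : ℝ → E} {f : E → E} {a : E →L[ℝ] ℝ} {t₁ t₂ : ℝ}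
    (hy : ∀ t ∈ Icc t₁ t₂, HasDerivWithinAt y (f (y t)) (Icc t₁ t₂) t)
    (htr : ∀ t ∈ Icc t₁ t₂, 0 < a (f (y t))) : StrictMonoOn (fun t => a (y t)) (Icc t₁ t₂) := by
  have hg : ∀ t ∈ Icc t₁ t₂, HasDerivWithinAt (fun t => a (y t)) (a (f (y t))) (Icc t₁ t₂) t :=
    fun t ht => a.hasFDerivAt.comp_hasDerivWithinAt t (hy t ht)
  refine strictMonoOn_of_hasDerivWithinAt_pos (convex_Icc t₁ t₂)
    (fun t ht => (hg t ht).continuousWithinAt) (fun t ht => ?_) fun t ht =>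
      htr t (interior_subset ht)
  exact (hg t (interior_subset ht)).mono interior_subset

/-- **Unique transversal crossing of a section (the `C⁰` Poincaré map is well defined).** Let `y`
solve `y' = f(y)` on `[t₁, t₂]` transversally to the section `Π = {a = c}` (`a (f (y t)) > 0` on
the whole segment, e.g. because `a ∘ f > 0` on an enclosure of the segment), and let the window
`[s_lo, s_hi] ⊆ [t₁, t₂]` have `a (y s_lo) ≤ c ≤ a (y s_hi)`. Then `y` meets `Π` at exactly one
time `s ∈ [t₁, t₂]`, this time lies in the window, and `y` is strictly on the near side
`{a < c}` before `s` and strictly on the far side after `s`.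
[cite: WilczakZgliczynski2007, §7 Def. 11 and the defining equation of t_P]
[cite: Immler2018VerifiedODESolver, §2.2.2 (return time)] -/
theorem existsUnique_section_crossing {y : ℝ → E} {f : E → E} {a : E →L[ℝ] ℝ}
    {c t₁ t₂ slo shi : ℝ}
    (hy : ∀ t ∈ Icc t₁ t₂, HasDerivWithinAt y (f (y t)) (Icc t₁ t₂) t)
    (htr : ∀ t ∈ Icc t₁ t₂, 0 < a (f (y t))) (hlo : slo ∈ Icc t₁ t₂) (hhi : shi ∈ Icc t₁ t₂)
    (hle : slo ≤ shi) (hbefore : a (y slo) ≤ c) (hafter : c ≤ a (y shi)) :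
    ∃ s ∈ Icc slo shi, a (y s) = c ∧ (∀ t ∈ Icc t₁ t₂, a (y t) = c → t = s) ∧
      (∀ t ∈ Icc t₁ t₂, t < s → a (y t) < c) ∧ ∀ t ∈ Icc t₁ t₂, s < t → c < a (y t) := by
  have hmono := strictMonoOn_section_of_transversal hy htr
  have hcont : ContinuousOn (fun t => a (y t)) (Icc t₁ t₂) := fun t ht =>
    (a.hasFDerivAt.comp_hasDerivWithinAt t (hy t ht)).continuousWithinAt
  have hsub : Icc slo shi ⊆ Icc t₁ t₂ := Icc_subset_Icc hlo.1 hhi.2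
  obtain ⟨s, hs, hsc⟩ := intermediate_value_Icc hle (hcont.mono hsub) ⟨hbefore, hafter⟩
  have hs' : s ∈ Icc t₁ t₂ := hsub hs
  refine ⟨s, hs, hsc, fun t ht htc => hmono.injOn ht hs' (htc.trans hsc.symm), fun t ht hts => ?_,
    fun t ht hst => ?_⟩
  · simpa only [hsc] using hmono ht hs' hts
  · simpa only [hsc] using hmono hs' ht hst

/-- **First crossing.** If moreover the solution is given on `[t₀, t₂]` and stays strictly on the
near side `{a < c}` on `[t₀, t₁]` (as a rigorous integrator checks for every enclosure of the
approach phase), then the crossing time `s` of `existsUnique_section_crossing` is the FIRST (and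
only) time in `[t₀, t₂]` at which `y` meets `Π` (the first return time).
[cite: WilczakZgliczynski2007, §7 Def. 11 and the defining equation of t_P]
[cite: Immler2018VerifiedODESolver, §2.2.2 (first return time τ, Poincaré map P)] -/
theorem existsUnique_first_section_crossing {y : ℝ → E} {f : E → E} {a : E →L[ℝ] ℝ}
    {c t₀ t₁ t₂ slo shi : ℝ} (h₀₁ : t₀ ≤ t₁)
    (hy : ∀ t ∈ Icc t₀ t₂, HasDerivWithinAt y (f (y t)) (Icc t₀ t₂) t)
    (hnear : ∀ t ∈ Icc t₀ t₁, a (y t) < c)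
    (htr : ∀ t ∈ Icc t₁ t₂, 0 < a (f (y t))) (hlo : slo ∈ Icc t₁ t₂) (hhi : shi ∈ Icc t₁ t₂)
    (hle : slo ≤ shi) (hbefore : a (y slo) ≤ c) (hafter : c ≤ a (y shi)) :
    ∃ s ∈ Icc slo shi, a (y s) = c ∧ (∀ t ∈ Icc t₀ t₂, a (y t) = c → t = s) ∧
      ∀ t ∈ Icc t₀ t₂, t < s → a (y t) < c := by
  have hy' : ∀ t ∈ Icc t₁ t₂, HasDerivWithinAt y (f (y t)) (Icc t₁ t₂) t := fun t ht =>
    (hy t ⟨h₀₁.trans ht.1, ht.2⟩).mono (Icc_subset_Icc_left h₀₁)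
  obtain ⟨s, hs, hsc, huniq, hbef, -⟩ := existsUnique_section_crossing hy' htr hlo hhi hle hbefore
    hafter
  refine ⟨s, hs, hsc, fun t ht htc => ?_, fun t ht hts => ?_⟩
  · rcases le_or_gt t₁ t with h | h
    · exact huniq t ⟨h, ht.2⟩ htc
    · exact absurd htc (hnear t ⟨ht.1, h.le⟩).ne
  · rcases le_or_gt t₁ t with h | h
    · exact hbef t ⟨h, ht.2⟩ hts
    · exact hnear t ⟨ht.1, h.le⟩

end Crossing

section PoincareMap

variable {E : Type*} [NormedAddCommGroup E] [NormedSpace ℝ E]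

/-- **Derivative of the crossing time and of the Poincaré map** (`C¹` Poincaré map from a
`C¹` flow enclosure).  Let `u x`, `x ∈ W`, be solutions of `y' = f (y)` on `[0, h]` with values
in `S` (`IsSolutionFamily`), `f` continuous and bounded by `M` on `S`, let the family be
transversal to the section `{a = c}` (`0 < a (f (u x t))`), let `s x ∈ [0, h]` be crossing
times (`a (u x (s x)) = c`), let `x ↦ u x τ` be continuous within `W` at `x₀` for every
`τ ∈ [0, h]`, and let `J` be the derivative within `W` at `x₀` of the frozen-time flow map
`x ↦ u x (s x₀)`.  Then, with `P x = u x (s x)` and `m = a (f (P x₀)) > 0`,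
`s` has derivative `-(m⁻¹) • (a ∘ J)` and `P` has derivative `J - m⁻¹ • (a ∘ J) ⊗ f (P x₀)`
within `W` at `x₀` — i.e. `∂t_P/∂x = -⟨∇α(P), ∂φ/∂x⟩ / ⟨∇α(P), f(P)⟩` and
`∂P/∂x = f(P) ∂t_P/∂x + ∂φ/∂x`.
[cite: WilczakZgliczynski2007, §7 (formulas for ∂t_P/∂x_j and ∂P_i/∂x_j)]
[cite: Immler2018VerifiedODESolver, §2.2.2 Thm. 8] -/
theorem hasFDerivWithinAt_crossingTime_poincareMap {f : E → E} {S W : Set E} {h : ℝ}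
    {u : E → ℝ → E} (hu : IsSolutionFamily f S W h u) {M : ℝ} (hM : ∀ y ∈ S, ‖f y‖ ≤ M)
    (hfc : ContinuousOn f S) {a : E →L[ℝ] ℝ} {c : ℝ}
    (htr : ∀ x ∈ W, ∀ t ∈ Icc 0 h, 0 < a (f (u x t)))
    {s : E → ℝ} (hs : ∀ x ∈ W, s x ∈ Icc 0 h ∧ a (u x (s x)) = c)
    {x₀ : E} (hx₀ : x₀ ∈ W) (hcont : ∀ τ ∈ Icc 0 h, ContinuousWithinAt (fun x => u x τ) W x₀)
    {J : E →L[ℝ] E} (hJ : HasFDerivWithinAt (fun x => u x (s x₀)) J W x₀) :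
    HasFDerivWithinAt s (-((a (f (u x₀ (s x₀))))⁻¹ • a.comp J)) W x₀ ∧
      HasFDerivWithinAt (fun x => u x (s x))
        (J - (a (f (u x₀ (s x₀))))⁻¹ • (a.comp J).smulRight (f (u x₀ (s x₀)))) W x₀ := by
  -- notation
  set s₀ := s x₀ with hs₀def
  set p₀ := u x₀ s₀ with hp₀def
  set m := a (f p₀) with hmdef
  have hs₀ : s₀ ∈ Icc 0 h := (hs x₀ hx₀).1
  have hc₀ : a p₀ = c := (hs x₀ hx₀).2
  have hm : 0 < m := htr x₀ hx₀ s₀ hs₀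
  have hp₀S : p₀ ∈ S := hu.mem x₀ hx₀ s₀ hs₀
  -- eventually `x ∈ W`
  have hW : ∀ᶠ x in 𝓝[W] x₀, x ∈ W := eventually_mem_nhdsWithin
  -- the section coordinate is strictly increasing along every trajectory
  have hmono : ∀ x ∈ W, StrictMonoOn (fun t => a (u x t)) (Icc 0 h) := fun x hx =>
    strictMonoOn_section_of_transversal (hu.hasDerivWithinAt x hx) (htr x hx)
  -- speed bound: ‖u x τ - u x τ'‖ ≤ M |τ - τ'|
  have hspeed : ∀ x ∈ W, ∀ τ ∈ Icc 0 h, ∀ τ' ∈ Icc 0 h, ‖u x τ - u x τ'‖ ≤ M * |τ - τ'| := by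
    intro x hx τ hτ τ' hτ'
    have := (convex_Icc 0 h).norm_image_sub_le_of_norm_hasDerivWithin_le
      (hu.hasDerivWithinAt x hx) (fun t ht => hM _ (hu.mem x hx t ht)) hτ' hτ
    simpa [Real.norm_eq_abs] using this
  -- Step 1: continuity of the crossing time at x₀ within W
  have hsc : Tendsto s (𝓝[W] x₀) (𝓝 s₀) := by
    rw [Metric.tendsto_nhds]
    intro η hη
    have hup : ∀ᶠ x in 𝓝[W] x₀, s x < s₀ + η := by
      by_cases hτ : s₀ + η / 2 ≤ h
      · have hτm : s₀ + η / 2 ∈ Icc 0 h := ⟨hs₀.1.trans (by linarith), hτ⟩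
        have hlt : c < a (u x₀ (s₀ + η / 2)) :=
          hc₀.symm.trans_lt (hmono x₀ hx₀ hs₀ hτm (by linarith))
        have hev := ((a.continuous.tendsto _).comp (hcont _ hτm).tendsto).eventually_const_lt hlt
        filter_upwards [hev, hW] with x hx hxW
        have h1 : s x < s₀ + η / 2 := by
          rw [← (hmono x hxW).lt_iff_lt (hs x hxW).1 hτm]
          simpa only [(hs x hxW).2, Function.comp] using hx
        linarith
      · filter_upwards [hW] with x hxW
        have := (hs x hxW).1.2
        linarith [not_le.1 hτ]
    have hlow : ∀ᶠ x in 𝓝[W] x₀, s₀ - η < s x := by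
      by_cases hτ : 0 ≤ s₀ - η / 2
      · have hτm : s₀ - η / 2 ∈ Icc 0 h := ⟨hτ, by linarith [hs₀.2]⟩
        have hlt : a (u x₀ (s₀ - η / 2)) < c :=
          (hmono x₀ hx₀ hτm hs₀ (by linarith)).trans_eq hc₀
        have hev := ((a.continuous.tendsto _).comp (hcont _ hτm).tendsto).eventually_lt_const hlt
        filter_upwards [hev, hW] with x hx hxW
        have h1 : s₀ - η / 2 < s x := by
          rw [← (hmono x hxW).lt_iff_lt hτm (hs x hxW).1]
          simpa only [(hs x hxW).2, Function.comp] using hx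
        linarith
      · filter_upwards [hW] with x hxW
        have := (hs x hxW).1.1
        linarith [not_le.1 hτ]
    filter_upwards [hup, hlow] with x h1 h2
    rw [Real.dist_eq, abs_lt]
    constructor <;> linarith
  -- Step 2: the field along the segment between `s₀` and `s x` is close to `f p₀`
  have hus₀ : Tendsto (fun x => u x s₀) (𝓝[W] x₀) (𝓝 p₀) := (hcont s₀ hs₀).tendsto
  have hfield : ∀ ε > 0, ∀ᶠ x in 𝓝[W] x₀, ∀ τ ∈ uIcc s₀ (s x), ‖f (u x τ) - f p₀‖ ≤ ε := by
    intro ε hε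
    obtain ⟨ρ, hρ, hρf⟩ := Metric.continuousWithinAt_iff.1 (hfc p₀ hp₀S) ε hε
    have h1 : ∀ᶠ x in 𝓝[W] x₀, dist (u x s₀) p₀ < ρ / 2 :=
      Metric.tendsto_nhds.1 hus₀ (ρ / 2) (half_pos hρ)
    have h2 : ∀ᶠ x in 𝓝[W] x₀, M * dist (s x) s₀ < ρ / 2 := by
      have : Tendsto (fun x => M * dist (s x) s₀) (𝓝[W] x₀) (𝓝 (M * 0)) :=
        tendsto_const_nhds.mul (tendsto_iff_dist_tendsto_zero.1 hsc)
      rw [mul_zero] at this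
      exact this.eventually_lt_const (half_pos hρ)
    filter_upwards [h1, h2, hW] with x hx1 hx2 hxW τ hτ
    have hτI : τ ∈ Icc 0 h := uIcc_subset_Icc hs₀ (hs x hxW).1 hτ
    have hτd : |τ - s₀| ≤ dist (s x) s₀ := by
      rw [Real.dist_eq]
      exact abs_sub_left_of_mem_uIcc hτ
    have hM0 : 0 ≤ M := (norm_nonneg _).trans (hM p₀ hp₀S)
    have hd : dist (u x τ) p₀ < ρ := by
      calc dist (u x τ) p₀ ≤ ‖u x τ - u x s₀‖ + dist (u x s₀) p₀ := by
            rw [dist_eq_norm, dist_eq_norm]; exact norm_sub_le_norm_sub_add_norm_sub _ _ _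
        _ ≤ M * |τ - s₀| + dist (u x s₀) p₀ := by
            gcongr; exact hspeed x hxW τ hτI s₀ hs₀
        _ ≤ M * dist (s x) s₀ + dist (u x s₀) p₀ := by gcongr
        _ < ρ / 2 + ρ / 2 := add_lt_add hx2 hx1
        _ = ρ := by ring
    have := hρf (hu.mem x hxW τ hτI) hd
    rw [dist_eq_norm] at this
    exact this.le
  -- Step 3: the two error terms are small
  set E₁ : E → E := fun x => u x (s x) - u x s₀ - (s x - s₀) • f p₀ with hE₁
  set E₂ : E → E := fun x => u x s₀ - p₀ - J (x - x₀) with hE₂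
  have hE1 : E₁ =o[𝓝[W] x₀] fun x => s x - s₀ := by
    refine isLittleO_iff.2 fun ε hε => ?_
    filter_upwards [hfield ε hε, hW] with x hfx hxW
    have hIsub : uIcc s₀ (s x) ⊆ Icc 0 h := uIcc_subset_Icc hs₀ (hs x hxW).1
    have hφ : ∀ τ ∈ uIcc s₀ (s x), HasDerivWithinAt (fun τ => u x τ - τ • f p₀)
        (f (u x τ) - f p₀) (uIcc s₀ (s x)) τ := by
      intro τ hτ
      have h1 : HasDerivWithinAt (fun τ => u x τ - τ • f p₀) (f (u x τ) - (1 : ℝ) • f p₀)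
          (Icc 0 h) τ :=
        (hu.hasDerivWithinAt x hxW τ (hIsub hτ)).sub
          ((hasDerivWithinAt_id τ (Icc 0 h)).smul_const (f p₀))
      rw [one_smul] at h1
      exact h1.mono hIsub
    have := (convex_uIcc s₀ (s x)).norm_image_sub_le_of_norm_hasDerivWithin_le hφ hfx
      left_mem_uIcc right_mem_uIcc
    calc ‖E₁ x‖ = ‖(u x (s x) - s x • f p₀) - (u x s₀ - s₀ • f p₀)‖ := by
          simp only [hE₁]; congr 1; simp only [sub_smul]; abel
      _ ≤ ε * ‖s x - s₀‖ := this
  have hE2 : E₂ =o[𝓝[W] x₀] fun x => x - x₀ := hJ.isLittleO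
  set R : E → ℝ := fun x => a (E₁ x) + a (E₂ x) with hR
  -- Step 4: the key identity `m (s x - s₀) = -(a (J (x - x₀)) + R x)` on `W`
  have hl : ∀ᶠ x in 𝓝[W] x₀, s x - s₀ = -(m⁻¹ * (a (J (x - x₀)) + R x)) := by
    filter_upwards [hW] with x hxW
    have h1 : a (u x (s x)) - a p₀ = 0 := by rw [(hs x hxW).2, hc₀, sub_self]
    have h2 : a (u x (s x)) - a p₀ = (s x - s₀) * m + (a (J (x - x₀)) + R x) := by
      simp only [hR, hE₁, hE₂, map_sub, map_smul, smul_eq_mul]; ring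
    have h3 : (s x - s₀) * m = -(a (J (x - x₀)) + R x) := by linarith
    calc s x - s₀ = (s x - s₀) * m * m⁻¹ := by rw [mul_assoc, mul_inv_cancel₀ hm.ne', mul_one]
      _ = -(m⁻¹ * (a (J (x - x₀)) + R x)) := by rw [h3]; ring
  -- Step 5: `s x - s₀ = O(x - x₀)`, hence `R = o(x - x₀)`
  have hbig : (fun x => s x - s₀) =O[𝓝[W] x₀] fun x => x - x₀ := by
    have h0 : (fun x => m⁻¹ * a (E₁ x)) =o[𝓝[W] x₀] fun x => s x - s₀ :=
      ((a.isBigO_comp E₁ _).trans_isLittleO hE1).const_mul_left _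
    have h1 : (fun x => s x - s₀) =O[𝓝[W] x₀] fun x => m⁻¹ * a (E₁ x) + (s x - s₀) :=
      h0.right_isBigO_add
    have h2 : (fun x => -(m⁻¹ * (a (J (x - x₀)) + a (E₂ x)))) =ᶠ[𝓝[W] x₀]
        fun x => m⁻¹ * a (E₁ x) + (s x - s₀) := by
      filter_upwards [hl] with x hx
      rw [hx]; simp only [hR]; ring
    have h4 : (fun x => a (J (x - x₀))) =O[𝓝[W] x₀] fun x => x - x₀ := (a.comp J).isBigO_sub _ _
    have h5 : (fun x => a (E₂ x)) =O[𝓝[W] x₀] fun x => x - x₀ :=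
      (a.isBigO_comp E₂ _).trans hE2.isBigO
    exact h1.trans ((((h4.add h5).const_mul_left m⁻¹).neg_left).congr' h2 EventuallyEq.rfl)
  have hE1' : E₁ =o[𝓝[W] x₀] fun x => x - x₀ := hE1.trans_isBigO hbig
  have hRo : R =o[𝓝[W] x₀] fun x => x - x₀ :=
    ((a.isBigO_comp E₁ _).trans_isLittleO hE1').add ((a.isBigO_comp E₂ _).trans_isLittleO hE2)
  -- Step 6: the derivative of the crossing time
  have hds : HasFDerivWithinAt s (-(m⁻¹ • a.comp J)) W x₀ := by
    rw [hasFDerivWithinAt_iff_isLittleO]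
    refine (hRo.const_mul_left (-m⁻¹)).congr' ?_ EventuallyEq.rfl
    filter_upwards [hl] with x hx
    rw [← hs₀def, hx]
    simp only [neg_apply, smul_apply,
      ContinuousLinearMap.comp_apply, smul_eq_mul]
    ring
  -- Step 7: the derivative of the Poincaré map
  have hdP : HasFDerivWithinAt (fun x => u x (s x))
      (J - m⁻¹ • (a.comp J).smulRight (f p₀)) W x₀ := by
    rw [hasFDerivWithinAt_iff_isLittleO]
    have hsm : (fun x => R x • f p₀) =o[𝓝[W] x₀] fun x => x - x₀ :=
      ((((1 : ℝ →L[ℝ] ℝ).smulRight (f p₀)).isBigO_comp R _).trans_isLittleO hRo).congr_left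
        fun x => by simp
    have hsum : (fun x => (-m⁻¹) • (R x • f p₀) + E₁ x + E₂ x) =o[𝓝[W] x₀] fun x => x - x₀ :=
      ((hsm.const_smul_left (-m⁻¹)).add hE1').add hE2
    refine hsum.congr' ?_ EventuallyEq.rfl
    filter_upwards [hl] with x hx
    rw [← hs₀def, ← hp₀def]
    simp only [hE₁, hE₂]
    rw [hx]
    simp only [sub_apply, smul_apply,
      ContinuousLinearMap.smulRight_apply, ContinuousLinearMap.comp_apply]
    module
  exact ⟨hds, hdP⟩


/-- **Coordinate sections.**  The case `E = ℝ^ι`, `Π = {y | y j = c}` of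
`hasFDerivWithinAt_crossingTime_poincareMap` (the sections of CAPD-style integrators and the
hyperplane case of [Immler2018VerifiedODESolver, §6.7]), with the derivatives spelled out
entrywise: `D s v = -(J v) j / f_j (P x₀)` and
`(D P v) i = (J v) i - f_i (P x₀) (J v) j / f_j (P x₀)`, i.e.
`D P = (I - f (P x₀) e_jᵀ / f_j (P x₀)) · J`.
[cite: WilczakZgliczynski2007, §7 (formulas for ∂t_P/∂x_j and ∂P_i/∂x_j)]
[cite: Immler2018VerifiedODESolver, §6.7] -/
theorem hasFDerivWithinAt_poincareMap_coordSection {ι : Type*} [Fintype ι]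
    {f : (ι → ℝ) → ι → ℝ} {S W : Set (ι → ℝ)} {h : ℝ} {u : (ι → ℝ) → ℝ → ι → ℝ}
    (hu : IsSolutionFamily f S W h u) {M : ℝ} (hM : ∀ y ∈ S, ‖f y‖ ≤ M)
    (hfc : ContinuousOn f S) (j : ι) {c : ℝ} (htr : ∀ x ∈ W, ∀ t ∈ Icc 0 h, 0 < f (u x t) j)
    {s : (ι → ℝ) → ℝ} (hs : ∀ x ∈ W, s x ∈ Icc 0 h ∧ u x (s x) j = c)
    {x₀ : ι → ℝ} (hx₀ : x₀ ∈ W)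
    (hcont : ∀ τ ∈ Icc 0 h, ContinuousWithinAt (fun x => u x τ) W x₀)
    {J : (ι → ℝ) →L[ℝ] (ι → ℝ)} (hJ : HasFDerivWithinAt (fun x => u x (s x₀)) J W x₀) :
    ∃ Ds : (ι → ℝ) →L[ℝ] ℝ, ∃ DP : (ι → ℝ) →L[ℝ] (ι → ℝ),
      HasFDerivWithinAt s Ds W x₀ ∧ HasFDerivWithinAt (fun x => u x (s x)) DP W x₀ ∧
      (∀ v, Ds v = -(J v j) / f (u x₀ (s x₀)) j) ∧
      ∀ v i, DP v i = J v i - f (u x₀ (s x₀)) i * J v j / f (u x₀ (s x₀)) j := by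
  obtain ⟨hds, hdP⟩ := hasFDerivWithinAt_crossingTime_poincareMap hu hM hfc
    (a := ContinuousLinearMap.proj j) (c := c) htr hs hx₀ hcont hJ
  refine ⟨_, _, hds, hdP, fun v => ?_, fun v i => ?_⟩
  · simp only [neg_apply, smul_apply,
      ContinuousLinearMap.comp_apply, ContinuousLinearMap.proj_apply, smul_eq_mul]
    ring
  · simp only [sub_apply, smul_apply,
      ContinuousLinearMap.smulRight_apply, ContinuousLinearMap.comp_apply,
      ContinuousLinearMap.proj_apply, Pi.sub_apply, Pi.smul_apply, smul_eq_mul]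
    ring

end PoincareMap

end Literature.Analysis.ODE

end
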